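import Summits.CriticalPhenomena.Ising3DConformalLimit.Theorems.SubPtolemyFloor.Negative.MirrorBoxCostume
import Summits.CriticalPhenomena.Ising3DConformalLimit.Theorems.PerfectScreeningCoulombImpliesNontrivialIsothermOfOneArm
import HarnessLib

/-!
# `SubPtolemyFloor` (item stmt-CriticalPhenomena-15703): Tasaki's isotherm → one-arm transport with a general
# exponent — the round-2 idea `box-hyperscaling-isotherm` proved end to end, and its infrared window

Negative / structural knowledge about the crux
`Summit.CriticalPhenomena.Ising3DConformalLimit.Theses.SubPtolemyInterlacing.SubPtolemyFloor`
(route SubPtolemyInterlacing, r3), from the crux-triage panel (round 2, triager 1; evidence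
`Cruxes/SubPtolemyFloor/TRIAGE-r2-1.md`); THEOREM-ONLY, no definitions. It complements
`MirrorBoxCostume.lean` (triager 2: given `MirrorBox` the crux is the one-arm floor) and `IsothermCostume.lean`
(triager 2: the crux implies an isotherm floor with `δ₀ > 6/L - 1`) with the idea's OWN direction, proved:
Notation: `g(n) = ⟨σ₀σ_{n e₁}⟩_{β_c(3)}`, `M_n = ⟨σ₀⟩⁺_{Λ_n;β_c,0}` (wired FK–Ising one-arm probability),
`m(h) = magnetizationInField 3 β_c h`, `L = log₂(1+√2) = 1.27155…`; `MirrorBox(K)`: `M_n² ≤ K g(2n+2)` (`n ≥ 1`);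
`IsothermFloor(δ₀,c)`: `c h^{1/δ₀} ≤ m(h)` on `(0,1]`.

* `magnetizationInField_le_boxMag_add` — **Tasaki's ghost-field bound** `m(h) ≤ M_n + K₁ n² h` for all `h ≥ 0`,
  `n ≥ 1` (plus boxes dominate the plus state; GHS tangent line in the field; GHS volume monotonicity of the
  truncated functions with `m*(β_c) = 0`; infrared box sum) — the tree pieces of
  `PerfectScreeningCoulombImpliesNontrivialIsothermOfOneArm`, without its one-arm hypothesis.
* `oneArmFloor_of_isothermFloor` — **the idea's First lemma, proved**: `IsothermFloor(δ₀,c)`, `δ₀ > 1` ⟹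
  `M_n ≥ c' n^{-2/(δ₀-1)}` (`h = h₁ n^{-2δ₀/(δ₀-1)}`). `oneArmFloor_of_isothermFloor_three`: at the rigorous
  frontier `δ₀ = 3` (Aizenman–Barsky–Fernández's mean-field isotherm bound, valid in every `d ≥ 2`) it returns
  exactly Tasaki's `M_n ≥ c'/n` (vEGPS 2025 Thm 1.1, landed `boxMag_ge_inv`) — and `MirrorBox` then returns the
  Simon–Lieb exponent `2`: the thermodynamic gateway is closed at mean field.
* `subPtolemyFloor_of_mirrorBox_of_isothermFloor` — **the idea's headline, proved**: `MirrorBox(K) ∧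
  IsothermFloor(δ₀ > 1 + 4/L = 4.1458…)` ⟹ crux. All provable content of the line is this bookkeeping; what it
  leaves are `MirrorBox` (a one-arm UPPER bound `M_n ≤ C n^{-1/2}`, `boxMag_le_rpow_of_mirrorBox`, open) and
  `IsothermFloor(δ₀ > 4.1458)` (an unconditional non-mean-field isotherm exponent on `ℤ³`, rigorous frontier `3`).
* `delta_le_five_of_mirrorBox_of_isothermFloor` — infrared window: `MirrorBox ∧ IsothermFloor(δ₀ > 1)` force
  `δ₀ ≤ 5` (the `η = 0` case of Buckingham–Gunton's `2 - η ≤ d(δ-1)/(δ+1)`); consistent with `δ = 4.790`, and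
  the conjunction is false on `ℤ^d`, `d ≥ 5`, where `δ = 3`: `d = 3` is load-bearing.

References: D. van Engelenburg, C. Garban, R. Panis, F. Severo, arXiv:2510.23423 (2025), Thm 1.1 and §3.1
(the argument with `h_n = (ε/n)³` and the mean-field isotherm bound), Thm 2.20; H. Tasaki, Comm. Math. Phys. 113
(1987); M. Aizenman, D. Barsky, R. Fernández, J. Stat. Phys. 47 (1987) (`m(β_c,h) ≥ c h^{1/3}`); H. Duminil-Copin,
*Lectures on the Ising and Potts models* (2019), Thm. 4.8 (infrared bound).
-/

noncomputable section

namespace Summit.CriticalPhenomena.Ising3DConformalLimit.SubPtolemyFloorNegative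

open scoped BigOperators Classical
open Finset Literature.Probability.LatticeModels
open Summit.CriticalPhenomena.Ising3DConformalLimit.Theses.SubPtolemyInterlacing
open Summit.CriticalPhenomena.Ising3DConformalLimit.PerfectScreeningCoulombImpliesNontrivial
  (boxMag_le_zeroField_add_field_mul isingTrunc_plus_box_le_plusExpect sum_box_criticalTwoPoint_le)

/-! ## §E box-hyperscaling-isotherm: Tasaki's transport with exponent `δ₀`, and the line proved end to end -/

/-- `⟨σ₀⟩⁺_{box n;β_c,h}` written with `spinAt 0` is the `isingCorr` of `{0}`. [folklore] -/
theorem isingExpect_spinAt_zero_eq_isingCorr (n : ℕ) (h : ℝ) :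
    isingExpect (zdGraph 3) (box 3 n) (criticalBeta 3) h .plus (spinAt 0) =
      isingCorr (zdGraph 3) (box 3 n) (criticalBeta 3) h BoundaryCondition.plus {0} := by
  simp only [isingCorr]
  congr 1
  funext σ
  simp [spinProduct]

/-- **Tasaki's ghost-field bound** `m(β_c,h) ≤ M_n + K₁ n² h` (`h ≥ 0`, `n ≥ 1`): the plus boxes dominate the
plus state (`plusCorr_le_isingCorr_plus_box`), GHS tangent line in the field (`boxMag_le_zeroField_add_field_mul`),
GHS volume monotonicity of truncated functions with `m*(β_c) = 0` (`isingTrunc_plus_box_le_plusExpect`), and the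
infrared box sum `Σ_{y ∈ Λ_n} G(y) ≤ K n²` (`sum_box_criticalTwoPoint_le`). [cite: VanEngelenburgGarbanPanisSevero2025, §3.1, proof of Thm. 1.1 (ghost-field term ≤ C n² h)] -/
theorem magnetizationInField_le_boxMag_add :
    ∃ K₁ : ℝ, 0 < K₁ ∧ ∀ h : ℝ, 0 ≤ h → ∀ n : ℕ, 1 ≤ n →
      magnetizationInField 3 (criticalBeta 3) h ≤
        isingCorr (zdGraph 3) (box 3 n) (criticalBeta 3) 0 BoundaryCondition.plus {0} + K₁ * (n : ℝ) ^ 2 * h := by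
  obtain ⟨K, hK0, hK⟩ := sum_box_criticalTwoPoint_le
  have hβ : 0 < criticalBeta 3 := criticalBeta_pos_holds (d := 3) (by norm_num)
  refine ⟨criticalBeta 3 * K + 1, by positivity, fun h hh n hn => ?_⟩
  have h1 : magnetizationInField 3 (criticalBeta 3) h ≤
      isingExpect (zdGraph 3) (box 3 n) (criticalBeta 3) h .plus (spinAt 0) := by
    have hle := plusCorr_le_isingCorr_plus_box (d := 3) hβ.le hh
      (A := {0}) (L := n) (Finset.singleton_subset_iff.2 (zero_mem_box 3 n))
    rw [magnetizationInField_eq_plusCorr]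
    exact hle.trans_eq (isingExpect_spinAt_zero_eq_isingCorr n h).symm
  have hm0 : plusExpect 3 (criticalBeta 3) 0 (spinAt 0) = 0 :=
    spontaneousMagnetization_criticalBeta_eq_zero_holds (d := 3) (by norm_num)
  have h2 : ∀ y ∈ box 3 n,
      isingExpect (zdGraph 3) (box 3 n) (criticalBeta 3) 0 .plus (fun σ => spinAt 0 σ * spinAt y σ) -
          isingExpect (zdGraph 3) (box 3 n) (criticalBeta 3) 0 .plus (spinAt 0) *
            isingExpect (zdGraph 3) (box 3 n) (criticalBeta 3) 0 .plus (spinAt y) ≤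
        criticalTwoPoint 3 y := by
    intro y hy
    have hle := isingTrunc_plus_box_le_plusExpect (d := 3) hβ.le le_rfl (zero_mem_box 3 n) hy
    refine hle.trans ?_
    rw [hm0, zero_mul, sub_zero]
    exact le_of_eq rfl
  have h3 : ∑ y ∈ box 3 n,
      (isingExpect (zdGraph 3) (box 3 n) (criticalBeta 3) 0 .plus (fun σ => spinAt 0 σ * spinAt y σ) -
        isingExpect (zdGraph 3) (box 3 n) (criticalBeta 3) 0 .plus (spinAt 0) *
          isingExpect (zdGraph 3) (box 3 n) (criticalBeta 3) 0 .plus (spinAt y)) ≤ K * (n : ℝ) ^ 2 :=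
    (Finset.sum_le_sum h2).trans (hK n hn)
  have h4 := boxMag_le_zeroField_add_field_mul (d := 3) hβ.le hh n
  have h5 := isingExpect_spinAt_zero_eq_isingCorr n 0
  have hn2h : 0 ≤ (n : ℝ) ^ 2 * h := by positivity
  calc magnetizationInField 3 (criticalBeta 3) h
      ≤ isingExpect (zdGraph 3) (box 3 n) (criticalBeta 3) h .plus (spinAt 0) := h1
    _ ≤ isingExpect (zdGraph 3) (box 3 n) (criticalBeta 3) 0 .plus (spinAt 0) +
        criticalBeta 3 * (∑ y ∈ box 3 n,
          (isingExpect (zdGraph 3) (box 3 n) (criticalBeta 3) 0 .plus (fun σ => spinAt 0 σ * spinAt y σ) -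
            isingExpect (zdGraph 3) (box 3 n) (criticalBeta 3) 0 .plus (spinAt 0) *
              isingExpect (zdGraph 3) (box 3 n) (criticalBeta 3) 0 .plus (spinAt y))) * h := h4
    _ ≤ isingExpect (zdGraph 3) (box 3 n) (criticalBeta 3) 0 .plus (spinAt 0) +
        criticalBeta 3 * (K * (n : ℝ) ^ 2) * h := by
        gcongr
    _ = isingCorr (zdGraph 3) (box 3 n) (criticalBeta 3) 0 BoundaryCondition.plus {0} +
        (criticalBeta 3 * K) * ((n : ℝ) ^ 2 * h) := by rw [h5]; ring
    _ ≤ isingCorr (zdGraph 3) (box 3 n) (criticalBeta 3) 0 BoundaryCondition.plus {0} +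
        (criticalBeta 3 * K + 1) * ((n : ℝ) ^ 2 * h) := by
        have : criticalBeta 3 * K ≤ criticalBeta 3 * K + 1 := by linarith
        have := mul_le_mul_of_nonneg_right this hn2h
        linarith
    _ = isingCorr (zdGraph 3) (box 3 n) (criticalBeta 3) 0 BoundaryCondition.plus {0} +
        (criticalBeta 3 * K + 1) * (n : ℝ) ^ 2 * h := by ring

/-- **The idea's First lemma (Tasaki transport with exponent `δ₀`), proved**: an isotherm floor
`c h^{1/δ₀} ≤ m(β_c,h)` on `(0,1]` with `δ₀ > 1` gives the one-arm floor `M_n ≥ c' n^{-2/(δ₀-1)}` for `n ≥ 1`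
(`h = h₁ n^{-2δ₀/(δ₀-1)}` in `magnetizationInField_le_boxMag_add`; the ghost term is then half the floor).
[cite: VanEngelenburgGarbanPanisSevero2025, §3.1, proof of Thm. 1.1 (h_n = (ε/n)³ with the mean-field isotherm bound)] -/
theorem oneArmFloor_of_isothermFloor {δ₀ c : ℝ} (hδ : 1 < δ₀) (hc : 0 < c)
    (hI : ∀ h : ℝ, 0 < h → h ≤ 1 → c * h ^ (1 / δ₀) ≤ magnetizationInField 3 (criticalBeta 3) h) :
    ∃ c' : ℝ, 0 < c' ∧ ∀ n : ℕ, 1 ≤ n →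
      c' * (n : ℝ) ^ (-(2 / (δ₀ - 1))) ≤
        isingCorr (zdGraph 3) (box 3 n) (criticalBeta 3) 0 BoundaryCondition.plus {0} := by
  obtain ⟨K₁, hK₁, hT⟩ := magnetizationInField_le_boxMag_add
  have hδ0 : 0 < δ₀ := by linarith
  have hδ1 : 0 < δ₀ - 1 := by linarith
  -- exponents `e = 1/δ₀`, `p = δ₀/(δ₀-1)`: `p e = 1/(δ₀-1)`, `p (1-e) = 1`
  set e : ℝ := 1 / δ₀ with he
  set p : ℝ := δ₀ / (δ₀ - 1) with hp
  have he1 : e < 1 := by rw [he, div_lt_one hδ0]; exact hδ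
  have hp0 : 0 < p := by rw [hp]; positivity
  have hpe : p * e = 1 / (δ₀ - 1) := by
    rw [hp, he]; field_simp
  have hp1e : p * (1 - e) = 1 := by
    rw [hp, he]; field_simp
  -- the constant field scale `h₁ = min 1 (q^p)`, `q = c/(2K₁)`
  set q : ℝ := c / (2 * K₁) with hq
  have hq0 : 0 < q := by rw [hq]; positivity
  set h₁ : ℝ := min 1 (q ^ p) with hh₁
  have hh₁0 : 0 < h₁ := lt_min one_pos (Real.rpow_pos_of_pos hq0 p)
  have hh₁1 : h₁ ≤ 1 := min_le_left _ _
  have hh₁q : h₁ ^ (1 - e) ≤ q := by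
    have hle : h₁ ≤ q ^ p := min_le_right _ _
    calc h₁ ^ (1 - e) ≤ (q ^ p) ^ (1 - e) := Real.rpow_le_rpow hh₁0.le hle (by linarith)
      _ = q := by rw [← Real.rpow_mul hq0.le, hp1e, Real.rpow_one]
  refine ⟨c / 2 * h₁ ^ e, by positivity, fun n hn => ?_⟩
  have hn0 : (0 : ℝ) < n := by exact_mod_cast hn
  have hn1 : (1 : ℝ) ≤ n := by exact_mod_cast hn
  -- the field `h = h₁ n^{-2p} ∈ (0, 1]`
  set h : ℝ := h₁ * (n : ℝ) ^ (-(2 * p)) with hhdef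
  have hnp0 : 0 < (n : ℝ) ^ (-(2 * p)) := Real.rpow_pos_of_pos hn0 _
  have hnp1 : (n : ℝ) ^ (-(2 * p)) ≤ 1 := Real.rpow_le_one_of_one_le_of_nonpos hn1 (by linarith)
  have hh0 : 0 < h := mul_pos hh₁0 hnp0
  have hhle1 : h ≤ 1 := by
    calc h = h₁ * (n : ℝ) ^ (-(2 * p)) := rfl
      _ ≤ 1 * 1 := mul_le_mul hh₁1 hnp1 hnp0.le zero_le_one
      _ = 1 := one_mul 1
  -- `h^e = h₁^e n^{-2/(δ₀-1)}`, `h^{1-e} = h₁^{1-e} n^{-2}`, `h = h^e h^{1-e}`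
  have hhe : h ^ e = h₁ ^ e * (n : ℝ) ^ (-(2 / (δ₀ - 1))) := by
    rw [hhdef, Real.mul_rpow hh₁0.le hnp0.le, ← Real.rpow_mul hn0.le]
    congr 2
    rw [show -(2 * p) * e = -(2 * (p * e)) by ring, hpe]
    ring
  have hh1e : h ^ (1 - e) = h₁ ^ (1 - e) * (n : ℝ) ^ (-(2 : ℝ)) := by
    rw [hhdef, Real.mul_rpow hh₁0.le hnp0.le, ← Real.rpow_mul hn0.le]
    congr 2
    rw [show -(2 * p) * (1 - e) = -(2 * (p * (1 - e))) by ring, hp1e]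
    ring
  have hsplit : h = h ^ e * h ^ (1 - e) := by
    rw [← Real.rpow_add hh0, show e + (1 - e) = 1 by ring, Real.rpow_one]
  -- the ghost term is at most half the isotherm floor: `K₁ n² h ≤ (c/2) h^e`
  have hn2 : (n : ℝ) ^ 2 * (n : ℝ) ^ (-(2 : ℝ)) = 1 := by
    rw [← Real.rpow_natCast (n : ℝ) 2, ← Real.rpow_add hn0]
    norm_num
  have hghost : K₁ * (n : ℝ) ^ 2 * h ≤ c / 2 * h ^ e := by
    have step : K₁ * (n : ℝ) ^ 2 * h = K₁ * h₁ ^ (1 - e) * h ^ e := by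
      conv_lhs => rw [hsplit, hh1e]
      have : K₁ * (n : ℝ) ^ 2 * (h ^ e * (h₁ ^ (1 - e) * (n : ℝ) ^ (-(2 : ℝ)))) =
          K₁ * h₁ ^ (1 - e) * h ^ e * ((n : ℝ) ^ 2 * (n : ℝ) ^ (-(2 : ℝ))) := by ring
      rw [this, hn2, mul_one]
    rw [step]
    have hK₁q : K₁ * h₁ ^ (1 - e) ≤ c / 2 := by
      calc K₁ * h₁ ^ (1 - e) ≤ K₁ * q := mul_le_mul_of_nonneg_left hh₁q hK₁.le
        _ = c / 2 := by rw [hq]; field_simp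
    exact mul_le_mul_of_nonneg_right hK₁q (Real.rpow_nonneg hh0.le e)
  -- assemble: `c h^e ≤ m(h) ≤ M_n + K₁ n² h ≤ M_n + (c/2) h^e`
  have hIso := hI h hh0 hhle1
  have hTas := hT h hh0.le n hn
  have key : c / 2 * h ^ e ≤ isingCorr (zdGraph 3) (box 3 n) (criticalBeta 3) 0 BoundaryCondition.plus {0} := by
    have : c * h ^ (1 / δ₀) = c * h ^ e := by rw [he]
    linarith [hIso, hTas, hghost, this]
  calc c / 2 * h₁ ^ e * (n : ℝ) ^ (-(2 / (δ₀ - 1))) = c / 2 * h ^ e := by rw [hhe]; ring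
    _ ≤ _ := key

/-- **At the rigorous frontier the transport returns the known bound**: the mean-field isotherm floor
`c h^{1/3} ≤ m(β_c,h)` (Aizenman–Barsky–Fernández, every `d ≥ 2`) transports to Tasaki's `M_n ≥ c'/n`
(`2/(3-1) = 1`; landed independently as `boxMag_ge_inv`) — under `MirrorBox` this is the Simon–Lieb exponent
`2`, so the thermodynamic gateway adds nothing at mean field. [cite: VanEngelenburgGarbanPanisSevero2025, Thm. 1.1 and the paragraph after it (Tasaki's argument in d = 3)] -/
theorem oneArmFloor_of_isothermFloor_three {c : ℝ} (hc : 0 < c)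
    (hI : ∀ h : ℝ, 0 < h → h ≤ 1 → c * h ^ (1 / 3 : ℝ) ≤ magnetizationInField 3 (criticalBeta 3) h) :
    ∃ c' : ℝ, 0 < c' ∧ ∀ n : ℕ, 1 ≤ n →
      c' * (n : ℝ) ^ (-(1 : ℝ)) ≤ isingCorr (zdGraph 3) (box 3 n) (criticalBeta 3) 0 BoundaryCondition.plus {0} := by
  have h := oneArmFloor_of_isothermFloor (δ₀ := 3) (by norm_num) hc hI
  norm_num at h
  exact h

/-- Threshold bookkeeping: `1 + 4/L < δ₀` gives `2·(2/(δ₀-1)) < L` (`L = log₂(1+√2) > 0`). [folklore] -/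
theorem two_mul_tasakiExponent_lt_threshold {δ₀ : ℝ}
    (hδ : 1 + 4 / Real.logb 2 (1 + Real.sqrt 2) < δ₀) :
    2 * (2 / (δ₀ - 1)) < Real.logb 2 (1 + Real.sqrt 2) := by
  have hL : 0 < Real.logb 2 (1 + Real.sqrt 2) := by linarith [one_lt_threshold]
  have h4 : 4 / Real.logb 2 (1 + Real.sqrt 2) < δ₀ - 1 := by linarith
  have hδ1 : 0 < δ₀ - 1 := lt_trans (by positivity) h4
  rw [show 2 * (2 / (δ₀ - 1)) = 4 / (δ₀ - 1) by ring, div_lt_iff₀ hδ1]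
  have := (div_lt_iff₀ hL).1 h4
  linarith

/-- **The idea's headline, proved**: `MirrorBox(K)` and an isotherm floor `c h^{1/δ₀} ≤ m(β_c,h)` on `(0,1]`
with `δ₀ > 1 + 4/log₂(1+√2) = 4.1458…` give `SubPtolemyFloor` (`oneArmFloor_of_isothermFloor` +
`crux_of_mirrorBox_of_oneArmFloor`). All provable content of the line is this bookkeeping; what it leaves
are `MirrorBox` (a one-arm upper bound, `boxMag_le_rpow_of_mirrorBox`) and `IsothermFloor(δ₀ > 4.1458)` — an
unconditional non-mean-field isotherm exponent on `ℤ³` (rigorous frontier `δ₀ = 3`) — themselves. [folklore] -/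
theorem subPtolemyFloor_of_mirrorBox_of_isothermFloor {K : ℝ} (hK : 0 < K)
    (hMB : ∀ n : ℕ, 1 ≤ n →
      isingCorr (zdGraph 3) (box 3 n) (criticalBeta 3) 0 BoundaryCondition.plus {0} ^ 2 ≤
        K * criticalTwoPoint 3 (((2 * n + 2 : ℕ) : ℤ) • (Pi.single 0 1 : Site 3)))
    {δ₀ c : ℝ} (hδ : 1 + 4 / Real.logb 2 (1 + Real.sqrt 2) < δ₀) (hc : 0 < c)
    (hI : ∀ h : ℝ, 0 < h → h ≤ 1 → c * h ^ (1 / δ₀) ≤ magnetizationInField 3 (criticalBeta 3) h) :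
    SubPtolemyFloor := by
  have hL : 0 < Real.logb 2 (1 + Real.sqrt 2) := by linarith [one_lt_threshold]
  have h4 : 0 < 4 / Real.logb 2 (1 + Real.sqrt 2) := by positivity
  have hδ1 : 1 < δ₀ := by linarith
  obtain ⟨c', hc', hcM⟩ := oneArmFloor_of_isothermFloor hδ1 hc hI
  exact crux_of_mirrorBox_of_oneArmFloor hK hMB
    ⟨2 / (δ₀ - 1), c', two_mul_tasakiExponent_lt_threshold hδ, hc', hcM⟩

/-- **Infrared window for the isotherm factor**: `MirrorBox(K)` and an isotherm floor with exponent `δ₀ > 1`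
force `δ₀ ≤ 5` — the `η = 0` instance of Buckingham–Gunton's `2 - η ≤ d(δ-1)/(δ+1)` read through the infrared
bound (`(c'²/K) n^{-4/(δ₀-1)} ≤ g(n)` and `exponent_ge_one`); consistent with `δ = 4.790`, and the conjunction is
FALSE on `ℤ^d`, `d ≥ 5` (`δ = 3` there): `d = 3` is load-bearing, as the idea says. [cite: DuminilCopin2019, Thm. 4.8, §4.4] -/
theorem delta_le_five_of_mirrorBox_of_isothermFloor {K : ℝ} (hK : 0 < K)
    (hMB : ∀ n : ℕ, 1 ≤ n →
      isingCorr (zdGraph 3) (box 3 n) (criticalBeta 3) 0 BoundaryCondition.plus {0} ^ 2 ≤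
        K * criticalTwoPoint 3 (((2 * n + 2 : ℕ) : ℤ) • (Pi.single 0 1 : Site 3)))
    {δ₀ c : ℝ} (hδ : 1 < δ₀) (hc : 0 < c)
    (hI : ∀ h : ℝ, 0 < h → h ≤ 1 → c * h ^ (1 / δ₀) ≤ magnetizationInField 3 (criticalBeta 3) h) :
    δ₀ ≤ 5 := by
  obtain ⟨c', hc', hcM⟩ := oneArmFloor_of_isothermFloor hδ hc hI
  have hfl := axisFloor_of_mirrorBox_of_oneArmFloor hK hc' hMB hcM
  have h1 := exponent_ge_one (a := 2 * (2 / (δ₀ - 1))) (c := c' ^ 2 / K) (by positivity) hfl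
  have hδ1 : 0 < δ₀ - 1 := by linarith
  rw [show 2 * (2 / (δ₀ - 1)) = 4 / (δ₀ - 1) by ring, le_div_iff₀ hδ1] at h1
  linarith

end Summit.CriticalPhenomena.Ising3DConformalLimit.SubPtolemyFloorNegative

end
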